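/-
Copyright (c) 2026. All rights reserved.
Released under Apache 2.0 license as described in the file LICENSE.
Authors: abc-iut cell, prover seat abc-iut-w5-d097 (wave 5), over the statements of abc-iut-L4-t3.
-/
import Literature.AnabelianGeometry.AbsoluteAnabelian.LogFrobeniusIncompatibility
import Literature.AnabelianGeometry.AbsoluteAnabelian.LogFrobeniusLogWallOfObstruction
import HarnessLib

/-!
# [AbsTopIII] Corollary 5.5 (iv), second sentence (`Cor55NotSimultaneouslyCompatible`): REDUCTION to the
# component-level two-path obstruction of Lemma-3.4 type at one place

S. Mochizuki, *Topics in absolute anabelian geometry III: global reconstruction algorithms*,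
J. Math. Sci. Univ. Tokyo 22 (2015) 939–1156 [MochizukiAbsTopIII2015]; locators = pages of the author's manuscript
(`paper:url-5493eb38cbb7`): Cor 5.5 (iv) p. 131 (second sentence: "the telecore structure `𝔗_{An•}` of (ii), the
contact structure `ℋ_{An•}` of (ii), and the observables `S_log`, `S_log⊞` of (iii) are not simultaneously
compatible"), proof pp. 132–133 ("the incompatibility of the introduction of a single model `(Γ⃗^log_v)_□` … that
maps isomorphically … to each copy `(Γ⃗^log_v)_⋎` … entirely similar to the proofs of assertion (iv) of Corollaries
3.6, 4.5"), and the mechanism of Cor 3.6 (iv) p. 81 l. 27–42 ("by writing out explicitly the meaning of such an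
equality `ζ'₁ = ζ₂`, we conclude that we obtain a contradiction to Lemma 3.4").

Proof-only companion (no new notion, no named `Prop`) of abc-iut-L4-t3's `LogFrobeniusIncompatibility.lean`
(the named fact `LogFrobeniusSetting.Cor55NotSimultaneouslyCompatible L T`, FACT-LIST F-3190; cone node
AbsTopIII:Cor5.5(iv)).  The statement is DERIVED from the SAME component-level input at ONE place `v₀` as the
first sentence (`LogFrobeniusLogWallOfObstruction.lean`, `cor55LogWall_of_twoPathObstruction`, F-3082):
* `cor55NotSimultaneouslyCompatible_of_twoPathObstruction` — the role played in the first sentence by the core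
  homotopy `ζ₀` of `□` for the pair (`[id_{⋎+1}]`, `[id_⋎]∘[log]`) is played by the TELECORE and its CONTACT
  STRUCTURE: in any common family `K` on `D_{An•}` containing `𝔍` and `ℋ_{An•}`, (A) the contact generator pair
  `([β⁰_□],[β¹_□])` (`[β¹_□]` = descend from `□` via `λ⊞_{v,ν}`, `𝒩⊞_v → 𝒩_v → ℰ• → An•[𝒳]`, return via `φ_□`)
  pre-composed with `[id_{⋎+1}]`, (B) the CORE homotopy of `An•[𝒳]` for the co-verticial pair
  (`[id_{⋎+1}]∘descend`, `[log]∘[id_⋎]∘descend`) (Def 3.5 (iii)), restricted to `𝔍` (Def 3.5 (iv) (b)) and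
  post-composed with the telecore edge `φ_□`, (C) `([β¹_□],[β⁰_□])` pre-composed with `[id_⋎]∘[log]`, compose to
  a homotopy for (`[id_{⋎+1}]`, `[id_⋎]∘[log]`) which is an ISOMORPHISM (each pair lies in the boundary set in both
  orders).  From there the argument is that of the first sentence verbatim: the `TS`-observable `S_log` at `v₀`
  (embedded into `K` by `CompatibleInTelecoreTS`) yields, for a two-path configuration `νu → νm → spaceLink`,
  `postLog → νc`, `νu → νc` of `Γ⃗^log_{v₀}` (at a NONARCHIMEDEAN `v₀`: `𝒪^× ↪ k̄^× ↪ k̄`, `k~ →(id) k~`,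
  `𝒪^× →(log) k~`), two homotopies of ONE pair of paths whose equality at an object `x₀` reads
  `λ_{νu}(a) ≫ ι_{ε₁} ≫ ι_{ε₂} ≫ ι_{ε₃} = ι_{ε₄}` for an isomorphism `a : x₀ ⥲ log(x₀)` — excluded by hypothesis.
* `cor55NotSimultaneouslyCompatible_of_nonarchObstruction` — the cast-free form at `isArc v₀ = false`; its
  hypothesis is literally that of `cor55LogWall_of_nonarchObstruction`, so ONE obstruction yields BOTH typed
  sentences of Cor 5.5 (iv) (F-3082 ∧ F-3190) by `And.intro`.
QUANTIFICATION NOTE: of the contact structure only the MEMBERSHIP of the generator pairs at `□` in its boundary set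
is used, of the telecore only Def 3.5 (iv) (b) and one edge `φ_□`, of the observables only `S_log` at `v₀`.
Refereed pre-IUT material; OUR kernel check of a typed statement; nothing here bears on [IUTchIII] Cor. 3.12; no
side taken; a reduction is not a discharge.
-/

set_option autoImplicit false

universe u

open CategoryTheory Quiver

namespace Literature.AnabelianGeometry.AbsoluteAnabelian

namespace LogFrobeniusSetting

variable {Vmod : Type u} {isArc : Vmod → Bool} (L : LogFrobeniusSetting Vmod isArc)

/-- Components of heterogeneously equal natural transformations (between propositionally equal functors) are
heterogeneously equal. [folklore] -/
private theorem app_heq_of_heq_natTrans {C : Type (u + 1)} [Category.{u} C] {D : Type (u + 1)} [Category.{u} D]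
    {F G F' G' : C ⥤ D} {α : F ⟶ G} {β : F' ⟶ G'} (h : HEq α β) (hF : F = F') (hG : G = G') (x : C) :
    HEq (α.app x) (β.app x) := by
  subst hF hG
  cases h
  rfl

/-- Components of a natural transformation at propositionally equal objects are heterogeneously equal. [folklore] -/
private theorem app_heq_app {C : Type (u + 1)} [Category.{u} C] {D : Type (u + 1)} [Category.{u} D]
    {F G : C ⥤ D} (α : F ⟶ G) {x y : C} (h : x = y) : HEq (α.app x) (α.app y) := by
  subst h
  rfl

/-- Images under propositionally equal functors of heterogeneously equal morphisms. [folklore] -/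
private theorem map_heq_map {C : Type (u + 1)} [Category.{u} C] {D : Type (u + 1)} [Category.{u} D]
    {F G : C ⥤ D} (hFG : F = G) {a b a' b' : C} (ha : a = a') (hb : b = b') {f : a ⟶ b} {g : a' ⟶ b'}
    (h : HEq f g) : HEq (F.map f) (G.map g) := by
  subst hFG ha hb
  cases h
  rfl

/-- A five-term identity between morphisms transported along heterogeneous equalities of its terms. [folklore] -/
private theorem eq_of_heq_chain {C : Type (u + 1)} [Category.{u} C] {o₀ o₁ o₂ o₃ o₄ c₀ c₁ c₂ c₃ c₄ : C}
    (h₀ : o₀ = c₀) (h₁ : o₁ = c₁) (h₂ : o₂ = c₂) (h₃ : o₃ = c₃) (h₄ : o₄ = c₄)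
    {κ₁ : o₀ ⟶ o₁} {κ₂ : o₁ ⟶ o₂} {κ₃ : o₂ ⟶ o₃} {κ₄ : o₃ ⟶ o₄} {κ₅ : o₀ ⟶ o₄}
    {n₁ : c₀ ⟶ c₁} {n₂ : c₁ ⟶ c₂} {n₃ : c₂ ⟶ c₃} {n₄ : c₃ ⟶ c₄} {n₅ : c₀ ⟶ c₄}
    (e₁ : HEq κ₁ n₁) (e₂ : HEq κ₂ n₂) (e₃ : HEq κ₃ n₃) (e₄ : HEq κ₄ n₄) (e₅ : HEq κ₅ n₅)
    (key : κ₅ = ((κ₁ ≫ κ₂) ≫ κ₃) ≫ κ₄) : n₁ ≫ n₂ ≫ n₃ ≫ n₄ = n₅ := by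
  subst h₀ h₁ h₂ h₃ h₄
  cases e₁; cases e₂; cases e₃; cases e₄; cases e₅
  simpa only [Category.assoc] using key.symm

/-- Components of a homotopy given by the whiskering axiom of Def 3.5 (ii) (b), read heterogeneously.
[folklore] -/
private theorem heq_app_of_eq_whisker {C₁ C₂ C₃ C₄ : Type (u + 1)} [Category.{u} C₁] [Category.{u} C₂]
    [Category.{u} C₃] [Category.{u} C₄] {F : C₁ ⥤ C₂} {P Q : C₂ ⥤ C₃} {G : C₃ ⥤ C₄} {A B : C₁ ⥤ C₄}
    (η : P ⟶ Q) {θ : A ⟶ B} {E : A = F ⋙ (P ⋙ G)} {E' : F ⋙ (Q ⋙ G) = B}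
    (W : θ = eqToHom E ≫ Functor.whiskerLeft F (Functor.whiskerRight η G) ≫ eqToHom E') (x : C₁) :
    HEq (θ.app x) (G.map (η.app (F.obj x))) := by
  subst E E' W
  rw [eqToHom_refl, eqToHom_refl, Category.id_comp, Category.comp_id]
  rfl

/-- Transport of `IsIso` along a heterogeneous equality of morphisms with propositionally equal endpoints. [folklore] -/
private theorem isIso_of_heq_hom {C : Type*} [Category C] {a b a' b' : C} (ha : a = a') (hb : b = b')
    {f : a ⟶ b} {g : a' ⟶ b'} (h : HEq f g) (hf : IsIso f) : IsIso g := by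
  subst ha hb
  cases h
  exact hf

/-- In a family of homotopies, the homotopy of a pair whose swap is also a boundary pair is an isomorphism (its
inverse is the homotopy of the swapped pair: Def 3.5 (ii) (b), `ζ_{(γ,γ)} = id` and transitivity).
[cite: MochizukiAbsTopIII2015, Definition 3.5 (ii) p.75] -/
private theorem isIso_η_of_mem_swap {V : Type u} [Quiver.{u} V] {D : DiagramOfCategories.{u, u + 1, u} V}
    (K : D.HomotopyFamily) {a b : V} {p q : Path a b} (h : K.E p q) (h' : K.E q p) : IsIso (K.η h) := by
  refine ⟨K.η h', ?_, ?_⟩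
  · rw [← K.η_trans h h', K.η_refl]
  · rw [← K.η_trans h' h, K.η_refl]

/-- **[AbsTopIII] Cor 5.5 (iv), second sentence (`Cor55NotSimultaneouslyCompatible`), REDUCED to a component-level
two-path obstruction at one place** (the Cor 3.6 (iv) / Lemma 3.4 mechanism).  Data and hypothesis EXACTLY as in
`cor55LogWall_of_twoPathObstruction`: a place `v₀`; pre-log vertices `νu`, `νm`, `νc` and arrows `ε₁ : νu → νm`,
`ε₂ : νm → spaceLink`, `ε₃ : postLog → νc`, `ε₄ : νu → νc` of `Γ⃗^log_{v₀}`; an object `x₀` of `𝒳`; for NO isomorphism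
`a : x₀ ⥲ log(x₀)` does `λ_{νu}(a) ≫ m₁ ≫ m₂ ≫ m₃ = m₄` hold with `m₁, m₂` the components of `ι_{ε₁}, ι_{ε₂}` at
`log(x₀)` and `m₃, m₄` those of `ι_{ε₃}, ι_{ε₄}` at `x₀` (compared by `HEq`).  Conclusion: no telecore `𝔗_{An•}` with
contact structure `ℋ_{An•}` (pinned generators) and observables `S_log⊞`, `S_log` at every `v` embed into one family of
homotopies on `D_{An•}`. [cite: MochizukiAbsTopIII2015, Cor 5.5 (iv) p. 131] -/
theorem cor55NotSimultaneouslyCompatible_of_twoPathObstruction (T : L.TSHomotopies) (v₀ : Vmod)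
    (νu νm νc : LogVertex (isArc v₀))
    (hu : νu.isPostLog = false) (hm : νm.isPostLog = false) (hc : νc.isPostLog = false)
    (ε₁ : LogEdgeTS (isArc v₀) νu νm) (ε₂ : LogEdgeTS (isArc v₀) νm (LogVertex.spaceLink (isArc v₀)))
    (ε₃ : LogEdgeTS (isArc v₀) (LogVertex.postLog (isArc v₀)) νc) (ε₄ : LogEdgeTS (isArc v₀) νu νc) (x₀ : L.X)
    (obstruction : ∀ (a : x₀ ⟶ L.log.obj x₀), IsIso a →
      ∀ (m₁ : (L.lam v₀ νu ⋙ L.forget v₀).obj (L.log.obj x₀) ⟶ (L.lam v₀ νm ⋙ L.forget v₀).obj (L.log.obj x₀))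
        (m₂ : (L.lam v₀ νm ⋙ L.forget v₀).obj (L.log.obj x₀) ⟶
          (L.lam v₀ (LogVertex.spaceLink (isArc v₀)) ⋙ L.forget v₀).obj (L.log.obj x₀))
        (m₃ : (L.lam v₀ (LogVertex.spaceLink (isArc v₀)) ⋙ L.forget v₀).obj (L.log.obj x₀) ⟶
          (L.lam v₀ νc ⋙ L.forget v₀).obj x₀)
        (m₄ : (L.lam v₀ νu ⋙ L.forget v₀).obj x₀ ⟶ (L.lam v₀ νc ⋙ L.forget v₀).obj x₀),
        HEq m₁ ((T.iota v₀ ε₁).app (L.log.obj x₀)) → HEq m₂ ((T.iota v₀ ε₂).app (L.log.obj x₀)) →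
        HEq m₃ ((T.iota v₀ ε₃).app x₀) → HEq m₄ ((T.iota v₀ ε₄).app x₀) →
          (L.lam v₀ νu ⋙ L.forget v₀).map a ≫ m₁ ≫ m₂ ≫ m₃ ≠ m₄) :
    L.Cor55NotSimultaneouslyCompatible T := by
  rintro ⟨H, hH, hcore, Tl, hJ, -, Hc, Hplus, Hts, K, -, hgen, hobsAll, hJK, hHcK, hcompat⟩
  obtain ⟨-, hpre, hpost⟩ := (hobsAll v₀).2
  have htsK := (hcompat v₀).2
  have hsl : (LogVertex.spaceLink (isArc v₀)).isPostLog = false := spaceLink_isPostLog _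
  have hpl : (LogVertex.postLog (isArc v₀)).isPostLog = true := by
    generalize isArc v₀ = b; cases b <;> rfl
  /- (0) notation: the telecore shape `Γ⃗_{D_{An•}}`, its diagram, a telecore edge `φ_□`, the contact generator data -/
  let Sh : ExtShape.{u} (DSub (InFive (isArc := isArc))) := anTelecoreShape Tl.J
  let Dtel := L.anTelecoreDiagram Tl.J Tl.telMap
  have hJc : Tl.J ⟨.core, core_mem_five⟩ = PUnit.{u + 1} := by
    rw [hJ]; rfl
  obtain ⟨jc⟩ : Nonempty (Tl.J ⟨.core, core_mem_five⟩) := by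
    rw [hJc]; exact ⟨PUnit.unit⟩
  obtain ⟨vc, νc', hνc', vr, νr, hνr, hgenBy, -, -, -⟩ := hgen
  -- vertices and edges of `Γ⃗_{D_{An•}}` used below
  let b1 : Sh.Vertex := Sh.base ⟨.row1 (0 + 1), row1_mem_five (0 + 1)⟩
  let b0 : Sh.Vertex := Sh.base ⟨.row1 0, row1_mem_five 0⟩
  let bc : Sh.Vertex := Sh.base ⟨.core, core_mem_five⟩
  let eId1 : b1 ⟶ bc := show Sh.base ⟨.row1 (0 + 1), row1_mem_five (0 + 1)⟩ ⟶ Sh.base ⟨.core, core_mem_five⟩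
    from DEdge.toCore (0 + 1)
  let eLog : b1 ⟶ b0 := show Sh.base ⟨.row1 (0 + 1), row1_mem_five (0 + 1)⟩ ⟶ Sh.base ⟨.row1 0, row1_mem_five 0⟩
    from DEdge.log 0
  let eId0 : b0 ⟶ bc := show Sh.base ⟨.row1 0, row1_mem_five 0⟩ ⟶ Sh.base ⟨.core, core_mem_five⟩
    from DEdge.toCore 0
  let pId1 : Path b1 bc := (Path.nil : Path b1 b1).cons eId1
  let pLog : Path b1 bc := ((Path.nil : Path b1 b1).cons eLog).cons eId0
  -- `[β¹_□]` (descend from `□` through `λ⊞_{vc,νc'}`, `𝒩⊞ → 𝒩 → ℰ• → An•[𝒳]`, return via `φ_□`) and the descent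
  let pDesc : Path bc Sh.obs := descendPath Tl.J vc νc' hνc'
  let pBeta : Path bc bc := betaCorePath Tl.J vc νc' hνc' jc
  /- (1) the telecore/contact homotopy for `([id_1], [id_0]∘[log])`, an isomorphism in `K` -/
  -- (A)/(C): the contact generator pairs `([β⁰_□],[β¹_□])`, `([β¹_□],[β⁰_□])` lie in `E_{ℋ_{An•}} ⊆ E_K`
  have hA : Hc.E (Path.nil : Path bc bc) pBeta :=
    (hgenBy _ _).mpr (Saturation.base (Or.inr (Or.inl ⟨jc, rfl, rfl, Or.inr ⟨HEq.rfl, HEq.rfl⟩⟩)))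
  have hC : Hc.E pBeta (Path.nil : Path bc bc) :=
    (hgenBy _ _).mpr (Saturation.base (Or.inr (Or.inl ⟨jc, rfl, rfl, Or.inl ⟨HEq.rfl, HEq.rfl⟩⟩)))
  obtain ⟨kA, -⟩ := hHcK _ _ hA
  obtain ⟨kC, -⟩ := hHcK _ _ hC
  -- (B): the core homotopy of `An•[𝒳]` for (`[id_1]∘descend`, `[log]∘[id_0]∘descend`), restricted to `𝔍`, then `∘ φ_□`
  let X₅ : ExtShape.{u} (DSub (InFive (isArc := isArc))) := obsShape (InFive (isArc := isArc)) DVertex.an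
  let c1 : X₅.Vertex := X₅.base ⟨.row1 (0 + 1), row1_mem_five (0 + 1)⟩
  let c0 : X₅.Vertex := X₅.base ⟨.row1 0, row1_mem_five 0⟩
  let cc : X₅.Vertex := X₅.base ⟨.core, core_mem_five⟩
  let cDesc : Path cc X₅.obs :=
    ((((Path.nil : Path cc cc).cons
      (show X₅.base ⟨.core, core_mem_five⟩ ⟶ X₅.base ⟨.nplus vc, nplus_mem_five vc⟩ from DEdge.lam vc νc' hνc')).cons
      (show X₅.base ⟨.nplus vc, nplus_mem_five vc⟩ ⟶ X₅.base ⟨.nv vc, nv_mem_five vc⟩ from DEdge.forget vc)).cons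
      (show X₅.base ⟨.nv vc, nv_mem_five vc⟩ ⟶ X₅.base ⟨.e5, e5_mem_five⟩ from DEdge.toE vc)).cons
      (show X₅.base ⟨.e5, e5_mem_five⟩ ⟶ X₅.obs from DEdge.κAn)
  let q1 : Path c1 X₅.obs :=
    ((Path.nil : Path c1 c1).cons
      (show X₅.base ⟨.row1 (0 + 1), row1_mem_five (0 + 1)⟩ ⟶ X₅.base ⟨.core, core_mem_five⟩
        from DEdge.toCore (0 + 1))).comp cDesc
  let qL : Path c1 X₅.obs :=
    (((Path.nil : Path c1 c1).cons
      (show X₅.base ⟨.row1 (0 + 1), row1_mem_five (0 + 1)⟩ ⟶ X₅.base ⟨.row1 0, row1_mem_five 0⟩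
        from DEdge.log 0)).cons
      (show X₅.base ⟨.row1 0, row1_mem_five 0⟩ ⟶ X₅.base ⟨.core, core_mem_five⟩ from DEdge.toCore 0)).comp cDesc
  have hB : Tl.Jfam.E (pId1.comp pDesc) (pLog.comp pDesc) := (Tl.restrict_E q1 qL).mp (hcore.boundary_all q1 qL)
  have hB' : Tl.Jfam.E (pLog.comp pDesc) (pId1.comp pDesc) := (Tl.restrict_E qL q1).mp (hcore.boundary_all qL q1)
  have hBφ : Tl.Jfam.E (pId1.comp pBeta) (pLog.comp pBeta) :=
    Tl.Jfam.isSaturated.postcomp hB (phiCorePath Tl.J jc)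
  have hBφ' : Tl.Jfam.E (pLog.comp pBeta) (pId1.comp pBeta) :=
    Tl.Jfam.isSaturated.postcomp hB' (phiCorePath Tl.J jc)
  obtain ⟨kB, -⟩ := hJK _ _ hBφ
  obtain ⟨kB', -⟩ := hJK _ _ hBφ'
  -- the composite `[id_1] ~ [id_1]∘[β¹_□] ~ [log;id_0]∘[β¹_□] ~ [log;id_0]` and its reverse
  have k₀' : K.E pId1 pLog :=
    K.isSaturated.trans (K.isSaturated.trans (K.isSaturated.precomp kA pId1) kB) (K.isSaturated.precomp kC pLog)
  have k₀'' : K.E pLog pId1 :=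
    K.isSaturated.trans (K.isSaturated.trans (K.isSaturated.precomp kA pLog) kB') (K.isSaturated.precomp kC pId1)
  have hisoK : IsIso (K.η k₀') := isIso_η_of_mem_swap K k₀' k₀''
  /- (2) the four `TS`-pins at `v₀`, transported into `K` -/
  obtain ⟨hm₁, hpin₁⟩ := hpre νu νm ε₁ hu hm
  obtain ⟨hm₂, hpin₂⟩ := hpre νm (LogVertex.spaceLink (isArc v₀)) ε₂ hm hsl
  obtain ⟨hm₃, hpin₃⟩ := hpost (LogVertex.postLog (isArc v₀)) νc ε₃ hpl hc hsl 0
  obtain ⟨hm₄, hpin₄⟩ := hpre νu νc ε₄ hu hc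
  obtain ⟨t₁, ht₁⟩ := htsK _ _ hm₁
  obtain ⟨t₂, ht₂⟩ := htsK _ _ hm₂
  obtain ⟨t₃, ht₃⟩ := htsK _ _ hm₃
  obtain ⟨t₄, ht₄⟩ := htsK _ _ hm₄
  -- the `λ`-paths `[λ⊞_{ν}; 𝒩⊞ → 𝒩]` of `D_{An•}`
  let bN : Sh.Vertex := Sh.base ⟨.nv v₀, nv_mem_five v₀⟩
  let lamP : ∀ (ν : LogVertex (isArc v₀)) (hν : ν.isPostLog = false), Path bc bN :=
    fun ν hν => ((Path.nil : Path bc bc).cons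
      (show Sh.base ⟨.core, core_mem_five⟩ ⟶ Sh.base ⟨.nplus v₀, nplus_mem_five v₀⟩ from DEdge.lam v₀ ν hν)).cons
      (show Sh.base ⟨.nplus v₀, nplus_mem_five v₀⟩ ⟶ Sh.base ⟨.nv v₀, nv_mem_five v₀⟩ from DEdge.forget v₀)
  have t₁' : K.E (lamP νu hu) (lamP νm hm) := t₁
  have t₂' : K.E (lamP νm hm) (lamP _ hsl) := t₂
  have t₃' : K.E (pLog.comp (lamP _ hsl)) (pId1.comp (lamP νc hc)) := t₃
  have t₄' : K.E (lamP νu hu) (lamP νc hc) := t₄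
  /- (3) the two derivations of the pair `([λ_{νu}]∘[id_1], [λ_{νc}]∘[id_1])` -/
  have s1 : K.E (pId1.comp (lamP νu hu)) (pLog.comp (lamP νu hu)) :=
    K.isSaturated.precomp (K.isSaturated.postcomp k₀' (lamP νu hu)) Path.nil
  have s2 : K.E (pLog.comp (lamP νu hu)) (pLog.comp (lamP νm hm)) :=
    K.isSaturated.precomp (K.isSaturated.postcomp t₁' Path.nil) pLog
  have s3 : K.E (pLog.comp (lamP νm hm)) (pLog.comp (lamP _ hsl)) :=
    K.isSaturated.precomp (K.isSaturated.postcomp t₂' Path.nil) pLog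
  have s5 : K.E (pId1.comp (lamP νu hu)) (pId1.comp (lamP νc hc)) :=
    K.isSaturated.precomp (K.isSaturated.postcomp t₄' Path.nil) pId1
  -- `ζ'₁ = ζ₂`: two homotopies of ONE pair of paths coincide (a family assigns one homotopy per pair)
  have key : K.η s5 = ((K.η s1 ≫ K.η s2) ≫ K.η s3) ≫ K.η t₃' := by
    rw [← K.η_trans s1 s2, ← K.η_trans, ← K.η_trans]
  have keyx : (K.η s5).app x₀ = (((K.η s1).app x₀ ≫ (K.η s2).app x₀) ≫ (K.η s3).app x₀) ≫ (K.η t₃').app x₀ := by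
    have := NatTrans.congr_app key x₀
    simpa only [NatTrans.comp_app] using this
  /- (4) functor identities along the explicit paths (the path functors are recursive: propositional only) -/
  have E_nil : Dtel.pathFunctor (Path.nil : Path b1 b1) = 𝟭 L.X := DiagramOfCategories.pathFunctor_nil _ _
  have E_id1 : Dtel.pathFunctor pId1 = 𝟭 L.X := by
    simp only [pId1, DiagramOfCategories.pathFunctor_cons, DiagramOfCategories.pathFunctor_nil]; rfl
  have E_log : Dtel.pathFunctor pLog = L.log := by
    simp only [pLog, DiagramOfCategories.pathFunctor_cons, DiagramOfCategories.pathFunctor_nil]; rfl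
  have Q : ∀ (ν : LogVertex (isArc v₀)) (hν : ν.isPostLog = false),
      Dtel.pathFunctor (lamP ν hν) = L.lam v₀ ν ⋙ L.forget v₀ := by
    intro ν hν
    simp only [lamP, DiagramOfCategories.pathFunctor_cons, DiagramOfCategories.pathFunctor_nil]; rfl
  have E1c : ∀ (ν : LogVertex (isArc v₀)) (hν : ν.isPostLog = false),
      Dtel.pathFunctor (pId1.comp (lamP ν hν)) = L.lam v₀ ν ⋙ L.forget v₀ := by
    intro ν hν
    simp only [pId1, lamP, Path.comp_cons, Path.comp_nil, DiagramOfCategories.pathFunctor_cons,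
      DiagramOfCategories.pathFunctor_nil]; rfl
  have ELc : ∀ (ν : LogVertex (isArc v₀)) (hν : ν.isPostLog = false),
      Dtel.pathFunctor (pLog.comp (lamP ν hν)) = L.log ⋙ (L.lam v₀ ν ⋙ L.forget v₀) := by
    intro ν hν
    simp only [pLog, lamP, Path.comp_cons, Path.comp_nil, DiagramOfCategories.pathFunctor_cons,
      DiagramOfCategories.pathFunctor_nil]; rfl
  have PTS : ∀ (ν : LogVertex (isArc v₀)) (hν : ν.isPostLog = false),
      (L.logDiagramTS v₀).pathFunctor (lamPathTS v₀ ν hν) = L.lam v₀ ν ⋙ L.forget v₀ := by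
    intro ν hν
    simp only [lamPathTS, lamEdgeTS, forgetEdgeTS, DiagramOfCategories.pathFunctor_cons,
      DiagramOfCategories.pathFunctor_nil]; rfl
  have PTSd : (L.logDiagramTS v₀).pathFunctor (postLogDomPathTS v₀ 0 hsl) =
      L.log ⋙ (L.lam v₀ (LogVertex.spaceLink (isArc v₀)) ⋙ L.forget v₀) := by
    simp only [postLogDomPathTS, logEdgeTS, toCoreEdgeTS, lamEdgeTS, forgetEdgeTS,
      DiagramOfCategories.pathFunctor_cons, DiagramOfCategories.pathFunctor_nil]; rfl
  have PTSc : (L.logDiagramTS v₀).pathFunctor (postLogCodPathTS v₀ 0 νc hc) = L.lam v₀ νc ⋙ L.forget v₀ := by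
    simp only [postLogCodPathTS, toCoreEdgeTS, lamEdgeTS, forgetEdgeTS, DiagramOfCategories.pathFunctor_cons,
      DiagramOfCategories.pathFunctor_nil]; rfl
  /- (5) the five factors, heterogeneously: ζ'₀ = λ_{νu}(ζ₀), ι_{ε₁}, ι_{ε₂} at `log x₀`, ι_{ε₃}, and ζ₂ = ι_{ε₄} at `x₀` -/
  have ht₁' : HEq ((Hts v₀).η hm₁) (K.η t₁') := ht₁
  have ht₂' : HEq ((Hts v₀).η hm₂) (K.η t₂') := ht₂
  have ht₃' : HEq ((Hts v₀).η hm₃) (K.η t₃') := ht₃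
  have ht₄' : HEq ((Hts v₀).η hm₄) (K.η t₄') := ht₄
  -- the pins, as heterogeneous equalities of components of `K`
  have g₁ : ∀ y : L.X, HEq ((K.η t₁').app y) ((T.iota v₀ ε₁).app y) := fun y => by
    obtain ⟨o, o', H⟩ := hpin₁ y
    exact (app_heq_of_heq_natTrans ht₁' ((PTS νu hu).trans (Q νu hu).symm) ((PTS νm hm).trans (Q νm hm).symm) y).symm.trans
      ((conj_eqToHom_iff_heq' _ _ o o').mp H)
  have g₂ : ∀ y : L.X, HEq ((K.η t₂').app y) ((T.iota v₀ ε₂).app y) := fun y => by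
    obtain ⟨o, o', H⟩ := hpin₂ y
    exact (app_heq_of_heq_natTrans ht₂' ((PTS νm hm).trans (Q νm hm).symm) ((PTS _ hsl).trans (Q _ hsl).symm) y).symm.trans
      ((conj_eqToHom_iff_heq' _ _ o o').mp H)
  have g₃ : HEq ((K.η t₃').app x₀) ((T.iota v₀ ε₃).app x₀) := by
    obtain ⟨o, o', H⟩ := hpin₃ x₀
    exact (app_heq_of_heq_natTrans ht₃' (PTSd.trans (ELc _ hsl).symm) (PTSc.trans (E1c νc hc).symm) x₀).symm.trans
      ((conj_eqToHom_iff_heq' _ _ o o').mp H)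
  have g₄ : ∀ y : L.X, HEq ((K.η t₄').app y) ((T.iota v₀ ε₄).app y) := fun y => by
    obtain ⟨o, o', H⟩ := hpin₄ y
    exact (app_heq_of_heq_natTrans ht₄' ((PTS νu hu).trans (Q νu hu).symm) ((PTS νc hc).trans (Q νc hc).symm) y).symm.trans
      ((conj_eqToHom_iff_heq' _ _ o o').mp H)
  -- object identities at `x₀`
  have hx_nil : (Dtel.pathFunctor (Path.nil : Path b1 b1)).obj x₀ = x₀ := Functor.congr_obj E_nil x₀
  have hx_id1 : (Dtel.pathFunctor pId1).obj x₀ = x₀ := Functor.congr_obj E_id1 x₀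
  have hx_log : (Dtel.pathFunctor pLog).obj x₀ = L.log.obj x₀ := Functor.congr_obj E_log x₀
  -- the isomorphism `α : x₀ ⥲ log(x₀)` furnished by the telecore and its contact structure
  haveI := hisoK
  obtain ⟨a, ha⟩ : ∃ a : x₀ ⟶ L.log.obj x₀, a = eqToHom hx_id1.symm ≫ (K.η k₀').app x₀ ≫ eqToHom hx_log :=
    ⟨_, rfl⟩
  have ha_iso : IsIso a :=
    isIso_of_heq_hom hx_id1 hx_log ((conj_eqToHom_iff_heq' _ _ hx_id1.symm hx_log).mp ha).symm inferInstance
  have ha_heq : HEq ((K.η k₀').app ((Dtel.pathFunctor (Path.nil : Path b1 b1)).obj x₀)) a :=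
    (app_heq_app (K.η k₀') hx_nil).trans ((conj_eqToHom_iff_heq' _ _ hx_id1.symm hx_log).mp ha).symm
  have E_nilN : Dtel.pathFunctor (Path.nil : Path bN bN) = 𝟭 _ := DiagramOfCategories.pathFunctor_nil _ _
  -- (e1) ζ'₀ at `x₀` is `λ_{νu}(α)`
  have e1 : HEq ((K.η s1).app x₀) ((L.lam v₀ νu ⋙ L.forget v₀).map a) :=
    (heq_app_of_eq_whisker (K.η k₀') (K.η_whisker k₀' Path.nil (lamP νu hu)) x₀).trans
      (map_heq_map (Q νu hu) ((Functor.congr_obj E_id1 _).trans hx_nil)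
        ((Functor.congr_obj E_log _).trans (congrArg L.log.obj hx_nil)) ha_heq)
  -- (e2), (e3) `ι_{ε₁}`, `ι_{ε₂}` at `log x₀` (pre-composed with `[id_0]∘[log]`)
  have e2 : HEq ((K.η s2).app x₀) ((T.iota v₀ ε₁).app (L.log.obj x₀)) :=
    (heq_app_of_eq_whisker (K.η t₁') (K.η_whisker t₁' pLog Path.nil) x₀).trans
      (map_heq_map E_nilN (by rw [Functor.congr_obj (Q νu hu), hx_log, hu]; rfl)
        (by rw [Functor.congr_obj (Q νm hm), hx_log]) ((app_heq_app (K.η t₁') hx_log).trans (g₁ _)))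
  have e3 : HEq ((K.η s3).app x₀) ((T.iota v₀ ε₂).app (L.log.obj x₀)) :=
    (heq_app_of_eq_whisker (K.η t₂') (K.η_whisker t₂' pLog Path.nil) x₀).trans
      (map_heq_map E_nilN (by rw [Functor.congr_obj (Q νm hm), hx_log, hm]; rfl)
        (by rw [Functor.congr_obj (Q _ hsl), hx_log]) ((app_heq_app (K.η t₂') hx_log).trans (g₂ _)))
  -- (e5) ζ₂ = `ι_{ε₄}` at `x₀` (pre-composed with `[id_1]`)
  have e5 : HEq ((K.η s5).app x₀) ((T.iota v₀ ε₄).app x₀) :=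
    (heq_app_of_eq_whisker (K.η t₄') (K.η_whisker t₄' pId1 Path.nil) x₀).trans
      (map_heq_map E_nilN (by rw [Functor.congr_obj (Q νu hu), hx_id1, hu]; rfl)
        (by rw [Functor.congr_obj (Q νc hc), hx_id1]) ((app_heq_app (K.η t₄') hx_id1).trans (g₄ _)))
  /- (6) "writing out explicitly the meaning of `ζ'₁ = ζ₂`" at `x₀`: transport the five factors to the clean types
  and contradict the obstruction -/
  have h₀ : (Dtel.pathFunctor (pId1.comp (lamP νu hu))).obj x₀ = (L.lam v₀ νu ⋙ L.forget v₀).obj x₀ :=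
    Functor.congr_obj (E1c νu hu) x₀
  have h₁ : (Dtel.pathFunctor (pLog.comp (lamP νu hu))).obj x₀ =
      (L.lam v₀ νu ⋙ L.forget v₀).obj (L.log.obj x₀) := Functor.congr_obj (ELc νu hu) x₀
  have h₂ : (Dtel.pathFunctor (pLog.comp (lamP νm hm))).obj x₀ =
      (L.lam v₀ νm ⋙ L.forget v₀).obj (L.log.obj x₀) := Functor.congr_obj (ELc νm hm) x₀
  have h₃ : (Dtel.pathFunctor (pLog.comp (lamP _ hsl))).obj x₀ =
      (L.lam v₀ (LogVertex.spaceLink (isArc v₀)) ⋙ L.forget v₀).obj (L.log.obj x₀) :=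
    Functor.congr_obj (ELc _ hsl) x₀
  have h₄ : (Dtel.pathFunctor (pId1.comp (lamP νc hc))).obj x₀ = (L.lam v₀ νc ⋙ L.forget v₀).obj x₀ :=
    Functor.congr_obj (E1c νc hc) x₀
  obtain ⟨m₁, hm₁⟩ : ∃ m₁ : (L.lam v₀ νu ⋙ L.forget v₀).obj (L.log.obj x₀) ⟶
      (L.lam v₀ νm ⋙ L.forget v₀).obj (L.log.obj x₀), m₁ = eqToHom h₁.symm ≫ (K.η s2).app x₀ ≫ eqToHom h₂ :=
    ⟨_, rfl⟩
  obtain ⟨m₂, hm₂⟩ : ∃ m₂ : (L.lam v₀ νm ⋙ L.forget v₀).obj (L.log.obj x₀) ⟶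
      (L.lam v₀ (LogVertex.spaceLink (isArc v₀)) ⋙ L.forget v₀).obj (L.log.obj x₀),
      m₂ = eqToHom h₂.symm ≫ (K.η s3).app x₀ ≫ eqToHom h₃ := ⟨_, rfl⟩
  obtain ⟨m₃, hm₃⟩ : ∃ m₃ : (L.lam v₀ (LogVertex.spaceLink (isArc v₀)) ⋙ L.forget v₀).obj (L.log.obj x₀) ⟶
      (L.lam v₀ νc ⋙ L.forget v₀).obj x₀, m₃ = eqToHom h₃.symm ≫ (K.η t₃').app x₀ ≫ eqToHom h₄ := ⟨_, rfl⟩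
  obtain ⟨m₄, hm₄⟩ : ∃ m₄ : (L.lam v₀ νu ⋙ L.forget v₀).obj x₀ ⟶ (L.lam v₀ νc ⋙ L.forget v₀).obj x₀,
      m₄ = eqToHom h₀.symm ≫ (K.η s5).app x₀ ≫ eqToHom h₄ := ⟨_, rfl⟩
  have c₁ : HEq ((K.η s2).app x₀) m₁ := ((conj_eqToHom_iff_heq' _ _ h₁.symm h₂).mp hm₁).symm
  have c₂ : HEq ((K.η s3).app x₀) m₂ := ((conj_eqToHom_iff_heq' _ _ h₂.symm h₃).mp hm₂).symm
  have c₃ : HEq ((K.η t₃').app x₀) m₃ := ((conj_eqToHom_iff_heq' _ _ h₃.symm h₄).mp hm₃).symm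
  have c₄ : HEq ((K.η s5).app x₀) m₄ := ((conj_eqToHom_iff_heq' _ _ h₀.symm h₄).mp hm₄).symm
  exact obstruction a ha_iso m₁ m₂ m₃ m₄ (c₁.symm.trans e2) (c₂.symm.trans e3) (c₃.symm.trans g₃)
    (c₄.symm.trans e5) (eq_of_heq_chain h₀ h₁ h₂ h₃ h₄ e1 c₁ c₂ c₃ c₄ keyx)

/-- **[AbsTopIII] Cor 5.5 (iv), second sentence, from the NONARCHIMEDEAN two-path obstruction** at one place `v₀`
with `isArc v₀ = false` (the printed configuration `𝒪^× ↪ k̄^× ↪ k̄`, `k~ →(id) k~`, `𝒪^× →(log) k~` exists there,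
`exists_logTwoPath_of_eq_false`): "the logarithm on `𝒪^×_{k̄}` is not the restriction of a field identification
`k̄ ⥲ k~`" (Lemma 3.4) at some object `x₀` implies `L.Cor55NotSimultaneouslyCompatible T`.
[cite: MochizukiAbsTopIII2015, Cor 5.5 (iv) p. 131] -/
theorem cor55NotSimultaneouslyCompatible_of_nonarchObstruction (T : L.TSHomotopies) (v₀ : Vmod)
    (hv₀ : isArc v₀ = false) (x₀ : L.X)
    (obstruction : ∀ (νu νm νc : LogVertex (isArc v₀)) (_ : νu.isPostLog = false) (_ : νm.isPostLog = false)
      (_ : νc.isPostLog = false) (ε₁ : LogEdgeTS (isArc v₀) νu νm)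
      (ε₂ : LogEdgeTS (isArc v₀) νm (LogVertex.spaceLink (isArc v₀)))
      (ε₃ : LogEdgeTS (isArc v₀) (LogVertex.postLog (isArc v₀)) νc) (ε₄ : LogEdgeTS (isArc v₀) νu νc)
      (a : x₀ ⟶ L.log.obj x₀), IsIso a →
      ∀ (m₁ : (L.lam v₀ νu ⋙ L.forget v₀).obj (L.log.obj x₀) ⟶ (L.lam v₀ νm ⋙ L.forget v₀).obj (L.log.obj x₀))
        (m₂ : (L.lam v₀ νm ⋙ L.forget v₀).obj (L.log.obj x₀) ⟶
          (L.lam v₀ (LogVertex.spaceLink (isArc v₀)) ⋙ L.forget v₀).obj (L.log.obj x₀))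
        (m₃ : (L.lam v₀ (LogVertex.spaceLink (isArc v₀)) ⋙ L.forget v₀).obj (L.log.obj x₀) ⟶
          (L.lam v₀ νc ⋙ L.forget v₀).obj x₀)
        (m₄ : (L.lam v₀ νu ⋙ L.forget v₀).obj x₀ ⟶ (L.lam v₀ νc ⋙ L.forget v₀).obj x₀),
        HEq m₁ ((T.iota v₀ ε₁).app (L.log.obj x₀)) → HEq m₂ ((T.iota v₀ ε₂).app (L.log.obj x₀)) →
        HEq m₃ ((T.iota v₀ ε₃).app x₀) → HEq m₄ ((T.iota v₀ ε₄).app x₀) →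
          (L.lam v₀ νu ⋙ L.forget v₀).map a ≫ m₁ ≫ m₂ ≫ m₃ ≠ m₄) :
    L.Cor55NotSimultaneouslyCompatible T := by
  obtain ⟨νu, νm, νc, hu, hm, hc, ⟨ε₁⟩, ⟨ε₂⟩, ⟨ε₃⟩, ⟨ε₄⟩⟩ := exists_logTwoPath_of_eq_false (isArc v₀) hv₀
  exact L.cor55NotSimultaneouslyCompatible_of_twoPathObstruction T v₀ νu νm νc hu hm hc ε₁ ε₂ ε₃ ε₄ x₀
    (obstruction νu νm νc hu hm hc ε₁ ε₂ ε₃ ε₄)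

end LogFrobeniusSetting

end Literature.AnabelianGeometry.AbsoluteAnabelian
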